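import Mathlib
import Summits.ABC.ABC.Theses.GlobalQuasiLogDerivative

/-!
# Strategist r1 (second opinion) — typed census for crux `SmallCoherentNonConstant` (stmt-ABC-1690)

Companion to `Cruxes/SmallCoherentNonConstant/STRATEGY-CENSUS.md` Part II.  Nothing here is a route
item; these are the SIGNATURES of the statements discussed in the census (so that "≡ crux",
"provably dead", "vacuous for the summit" are claims about precise Props), plus proofs:
`crux_iff`, `crux_of_integralWitness`, `towerStep`, `pairForcing`, and the main result of Part II,
`integralRigid : IntegralRigid` — **for every ε < 1 the integral (denominator-free) sector of the
crux is rigid** (sorry-free, axioms propext/Classical.choice/Quot.sound) — with its corollary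
`no_integralWitness : ¬ IntegralWitness`; and the one-liner `rigidity_kills_crux`.

Notation (informal): `rad n = UniqueFactorizationMonoid.radical n`, `e n = n / rad n`,
`s n = k n / rad n`, `D x y = rad x * k y - rad y * k x = rad x * rad y * (s y - s x)`.
-/

set_option linter.dupNamespace false
set_option autoImplicit false

namespace Summit.ABC.ABC.Cruxes.SmallCoherentNonConstant.Strategist2

open Summit.ABC.ABC.Theses.GlobalQuasiLogDerivative

/-! ## 0. The three clauses of the crux, named -/

/-- COHERENT: `(x+y) ∣ rad(x+y)·D(x,y)` on coprime positive pairs (verbatim clause 1 of the crux). -/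
def Coh (k : ℕ → ℤ) : Prop :=
  ∀ x y : ℕ, 0 < x → 0 < y → Nat.Coprime x y →
    ((x + y : ℕ) : ℤ) ∣ ((UniqueFactorizationMonoid.radical (x + y) : ℕ) : ℤ) *
      (((UniqueFactorizationMonoid.radical x : ℕ) : ℤ) * k y -
        ((UniqueFactorizationMonoid.radical y : ℕ) : ℤ) * k x)

/-- (ε,C)-SMALL: `|D(x,y)| ≤ C·rad x·rad y·(x+y)^ε` on coprime positive pairs (verbatim clause 2). -/
def Sm (ε C : ℝ) (k : ℕ → ℤ) : Prop :=
  ∀ x y : ℕ, 0 < x → 0 < y → Nat.Coprime x y →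
    |((UniqueFactorizationMonoid.radical x : ℕ) : ℝ) * (k y : ℝ) -
        ((UniqueFactorizationMonoid.radical y : ℕ) : ℝ) * (k x : ℝ)| ≤
      C * ((UniqueFactorizationMonoid.radical x : ℕ) : ℝ) *
        ((UniqueFactorizationMonoid.radical y : ℕ) : ℝ) * ((x + y : ℕ) : ℝ) ^ ε

/-- NON-CONSTANT: `D(a,b) ≠ 0` for some positive `a, b` (verbatim clause 3). -/
def NC (k : ℕ → ℤ) : Prop :=
  ∃ a b : ℕ, 0 < a ∧ 0 < b ∧
    ((UniqueFactorizationMonoid.radical a : ℕ) : ℤ) * k b ≠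
      ((UniqueFactorizationMonoid.radical b : ℕ) : ℤ) * k a

/-- The crux is literally `∀ ε > 0, ∃ C k, Coh k ∧ Sm ε C k ∧ NC k` (definitional). -/
theorem crux_iff :
    SmallCoherentNonConstant ↔ ∀ ε : ℝ, 0 < ε → ∃ C : ℝ, ∃ k : ℕ → ℤ, Coh k ∧ Sm ε C k ∧ NC k :=
  Iff.rfl

/-! ## 1. STRENGTHEN — the integral (denominator-free) sector `k = rad · u`

`IntegralWitness` is the crux restricted to `s = u : ℕ → ℤ` integer-valued.  It implies the crux
(`crux_of_integralWitness`), it is alive at `ε ≥ 2` (`u n = n²`), and it is DEAD for every `ε < 1`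
(`IntegralRigid`, proved on paper in the census, Part II §Strengthen; the one-step forcing lemma
`towerStep` below is its engine).  Since `Bridge` needs `ε → 0`, the integral sector buys nothing. -/

/-- Coherence for an integral `u` (`k = rad·u`): `(x+y) ∣ rad(x+y)·(u y − u x)`, i.e. `e(x+y) ∣ u y − u x`. -/
def IntCoh (u : ℕ → ℤ) : Prop :=
  ∀ x y : ℕ, 0 < x → 0 < y → Nat.Coprime x y →
    ((x + y : ℕ) : ℤ) ∣ ((UniqueFactorizationMonoid.radical (x + y) : ℕ) : ℤ) * (u y - u x)

/-- Smallness for an integral `u`: `|u y − u x| ≤ C·(x+y)^ε`. -/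
def IntSm (ε C : ℝ) (u : ℕ → ℤ) : Prop :=
  ∀ x y : ℕ, 0 < x → 0 < y → Nat.Coprime x y → |(u y : ℝ) - (u x : ℝ)| ≤ C * ((x + y : ℕ) : ℝ) ^ ε

/-- S⁺₅ of the census: an INTEGRAL small coherent non-constant function for every ε > 0. -/
def IntegralWitness : Prop :=
  ∀ ε : ℝ, 0 < ε → ∃ C : ℝ, ∃ u : ℕ → ℤ, IntCoh u ∧ IntSm ε C u ∧ ∃ a b : ℕ, 0 < a ∧ 0 < b ∧ u a ≠ u b

/-- `IntegralWitness → crux` with `k n = rad n · u n` (so it is a genuine strengthening). -/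
theorem crux_of_integralWitness : IntegralWitness → SmallCoherentNonConstant := by
  intro h ε hε
  obtain ⟨C, u, hcoh, hsm, a, b, ha, hb, hne⟩ := h ε hε
  refine ⟨C, fun n => ((UniqueFactorizationMonoid.radical n : ℕ) : ℤ) * u n, ?_, ?_, ?_⟩
  · intro x y hx hy hxy
    have key := hcoh x y hx hy hxy
    have e : ((UniqueFactorizationMonoid.radical (x + y) : ℕ) : ℤ) *
        (((UniqueFactorizationMonoid.radical x : ℕ) : ℤ) *
            (((UniqueFactorizationMonoid.radical y : ℕ) : ℤ) * u y) -
          ((UniqueFactorizationMonoid.radical y : ℕ) : ℤ) *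
            (((UniqueFactorizationMonoid.radical x : ℕ) : ℤ) * u x)) =
        (((UniqueFactorizationMonoid.radical x : ℕ) : ℤ) *
            ((UniqueFactorizationMonoid.radical y : ℕ) : ℤ)) *
          (((UniqueFactorizationMonoid.radical (x + y) : ℕ) : ℤ) * (u y - u x)) := by ring
    rw [e]
    exact Dvd.dvd.mul_left key _
  · intro x y hx hy hxy
    have key := hsm x y hx hy hxy
    have hrx : (0 : ℝ) ≤ ((UniqueFactorizationMonoid.radical x : ℕ) : ℝ) := Nat.cast_nonneg _
    have hry : (0 : ℝ) ≤ ((UniqueFactorizationMonoid.radical y : ℕ) : ℝ) := Nat.cast_nonneg _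
    simp only [Int.cast_mul, Int.cast_natCast]
    have e : ((UniqueFactorizationMonoid.radical x : ℕ) : ℝ) *
          (((UniqueFactorizationMonoid.radical y : ℕ) : ℝ) * (u y : ℝ)) -
        ((UniqueFactorizationMonoid.radical y : ℕ) : ℝ) *
          (((UniqueFactorizationMonoid.radical x : ℕ) : ℝ) * (u x : ℝ)) =
        (((UniqueFactorizationMonoid.radical x : ℕ) : ℝ) *
            ((UniqueFactorizationMonoid.radical y : ℕ) : ℝ)) * ((u y : ℝ) - (u x : ℝ)) := by ring
    rw [e, abs_mul, abs_of_nonneg (mul_nonneg hrx hry)]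
    calc ((UniqueFactorizationMonoid.radical x : ℕ) : ℝ) *
            ((UniqueFactorizationMonoid.radical y : ℕ) : ℝ) * |(u y : ℝ) - (u x : ℝ)|
        ≤ ((UniqueFactorizationMonoid.radical x : ℕ) : ℝ) *
            ((UniqueFactorizationMonoid.radical y : ℕ) : ℝ) * (C * ((x + y : ℕ) : ℝ) ^ ε) :=
          mul_le_mul_of_nonneg_left key (mul_nonneg hrx hry)
      _ = C * ((UniqueFactorizationMonoid.radical x : ℕ) : ℝ) *
            ((UniqueFactorizationMonoid.radical y : ℕ) : ℝ) * ((x + y : ℕ) : ℝ) ^ ε := by ring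
  · refine ⟨a, b, ha, hb, ?_⟩
    intro hEq
    have hra : ((UniqueFactorizationMonoid.radical a : ℕ) : ℤ) ≠ 0 := by
      exact_mod_cast UniqueFactorizationMonoid.radical_ne_zero
    have hrb : ((UniqueFactorizationMonoid.radical b : ℕ) : ℤ) ≠ 0 := by
      exact_mod_cast UniqueFactorizationMonoid.radical_ne_zero
    have h0 : ((UniqueFactorizationMonoid.radical a : ℕ) : ℤ) *
        ((UniqueFactorizationMonoid.radical b : ℕ) : ℤ) * (u b - u a) = 0 := by
      linear_combination hEq
    rcases mul_eq_zero.mp h0 with h | h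
    · rcases mul_eq_zero.mp h with h | h
      · exact hra h
      · exact hrb h
    · exact hne (sub_eq_zero.mp h).symm

/-- ENGINE of `IntegralRigid` (one forcing step along a prime-power sum): if `n + m = p^(t+1)` with
`p ∤ n`, coherence gives `p^t ∣ u m − u n` and smallness `|u m − u n| ≤ C·p^((t+1)ε) < p^t` forces
`u m = u n`.  For an integral witness the archimedean window is `C·(x+y)^ε` with NO `rad x·rad y`
factor — that is the whole difference with the crux, where the window `C·rad x·rad y·(x+y)^ε`
swallows the modulus except at abc-hits (census R3, N-a). -/
theorem towerStep (C ε : ℝ) (u : ℕ → ℤ) (hcoh : IntCoh u) (hsm : IntSm ε C u)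
    {p t n m : ℕ} (hp : p.Prime) (hn : 0 < n) (hm : 0 < m) (hpn : ¬ p ∣ n)
    (hsum : n + m = p ^ (t + 1))
    (hgap : C * ((p ^ (t + 1) : ℕ) : ℝ) ^ ε < ((p ^ t : ℕ) : ℝ)) :
    u m = u n := by
  have hcop : Nat.Coprime n m := by
    have hg : Nat.gcd n m ∣ p ^ (t + 1) := by
      rw [← hsum]; exact Nat.dvd_add (Nat.gcd_dvd_left n m) (Nat.gcd_dvd_right n m)
    obtain ⟨i, -, hgi⟩ := (Nat.dvd_prime_pow hp).mp hg
    rcases i with _ | i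
    · simpa using hgi
    · have hpdn : p ^ (i + 1) ∣ n := by rw [← hgi]; exact Nat.gcd_dvd_left n m
      exact absurd ((dvd_pow_self p (Nat.succ_ne_zero i)).trans hpdn) hpn
  have hdvd := hcoh n m hn hm hcop
  rw [hsum] at hdvd
  have hrad : UniqueFactorizationMonoid.radical (p ^ (t + 1)) = p := by
    rw [Nat.radical_eq_prod_primeFactors, Nat.primeFactors_prime_pow (Nat.succ_ne_zero t) hp,
      Finset.prod_singleton]
  rw [hrad] at hdvd
  have hfac : ((p ^ (t + 1) : ℕ) : ℤ) = (p : ℤ) * ((p ^ t : ℕ) : ℤ) := by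
    push_cast; ring
  rw [hfac] at hdvd
  have hdvd' : ((p ^ t : ℕ) : ℤ) ∣ (u m - u n) :=
    (mul_dvd_mul_iff_left (by exact_mod_cast hp.ne_zero)).mp hdvd
  have hsmall := hsm n m hn hm hcop
  rw [hsum] at hsmall
  by_contra hne
  have hne' : u m - u n ≠ 0 := sub_ne_zero.mpr hne
  have hle : ((p ^ t : ℕ) : ℤ) ≤ |u m - u n| :=
    Int.le_of_dvd (abs_pos.mpr hne') ((dvd_abs _ _).mpr hdvd')
  have hleR : ((p ^ t : ℕ) : ℝ) ≤ |(u m : ℝ) - (u n : ℝ)| := by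
    have h1 := (Int.cast_le (R := ℝ)).mpr hle
    rw [Int.cast_natCast, Int.cast_abs, Int.cast_sub] at h1
    exact h1
  linarith

/-- INTEGRAL RIGIDITY (census Part II, Theorem S⁺₅ — PROVED below as `integralRigid`):
for every `ε < 1` and every `C`, an integral coherent `(ε,C)`-small `u` is constant on the positive
integers.  Proof (two-pair forcing): gauge at `1`; the pair `(1, y)` with `y + 1 = m^(R+1)` forces
`u y = u 1` as soon as `m^R > C·m^((R+1)ε)`; the pair `(N, y)` with `q² ∣ N + y`, `q > |u 1 − u N|`
prime, forces `u y = u N`.  Both constraints on `y` are congruences on `m` (CRT mod `q²` and `N`,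
Euler's theorem for `m^(R+1) ≡ m (mod q²)` with `φ(q²) ∣ R`), so `y` exists. Elementary; no Dirichlet. -/
def IntegralRigid : Prop :=
  ∀ ε C : ℝ, ε < 1 → ∀ u : ℕ → ℤ, IntCoh u → IntSm ε C u → ∀ a b : ℕ, 0 < a → 0 < b → u a = u b

/-- PAIR FORCING for an integral `u`: if `Q·rad(x+y) ∣ x+y` (i.e. `Q ∣ e(x+y)`) and `|u y − u x| < Q`
then `u y = u x`.  (`towerStep` is the case `x + y = p^(t+1)`, `Q = p^t`.) -/
theorem pairForcing (u : ℕ → ℤ) (hcoh : IntCoh u) {x y Q : ℕ} (hx : 0 < x) (hy : 0 < y)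
    (hxy : Nat.Coprime x y)
    (hQ : Q * UniqueFactorizationMonoid.radical (x + y) ∣ x + y)
    (hlt : |u y - u x| < (Q : ℤ)) : u y = u x := by
  have h := hcoh x y hx hy hxy
  obtain ⟨w, hw⟩ := hQ
  have hR0 : ((UniqueFactorizationMonoid.radical (x + y) : ℕ) : ℤ) ≠ 0 := by
    exact_mod_cast UniqueFactorizationMonoid.radical_ne_zero
  have e : ((x + y : ℕ) : ℤ) =
      ((UniqueFactorizationMonoid.radical (x + y) : ℕ) : ℤ) * ((Q : ℤ) * (w : ℤ)) := by
    conv_lhs => rw [hw]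
    push_cast; ring
  rw [e] at h
  have hQd : (Q : ℤ) ∣ u y - u x :=
    (dvd_mul_right (Q : ℤ) (w : ℤ)).trans ((mul_dvd_mul_iff_left hR0).mp h)
  exact sub_eq_zero.mp (Int.eq_zero_of_abs_lt_dvd hQd hlt)

/-- **Theorem S⁺₅ (integral rigidity below ε = 1).**  Sorry-free. -/
theorem integralRigid : IntegralRigid := by
  intro ε C hε u hcoh hsm
  suffices key : ∀ N : ℕ, 0 < N → u N = u 1 by
    intro a b ha hb; rw [key a ha, key b hb]
  intro N hN
  by_cases hN1 : N = 1
  · subst hN1; rfl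
  have hN2 : 2 ≤ N := by omega
  -- (1) a prime q > max |u 1 - u N| N
  obtain ⟨q, hqge, hq⟩ := Nat.exists_infinite_primes (max (u 1 - u N).natAbs N + 1)
  have hqN : N < q := by
    have := le_max_right (u 1 - u N).natAbs N; omega
  have hqabs : (u 1 - u N).natAbs < q := by
    have := le_max_left (u 1 - u N).natAbs N; omega
  have hqq2 : q ≤ q ^ 2 := Nat.le_self_pow (by norm_num) q
  -- (2) exponent: R₀ = φ(q²)·t with (t : ℝ)·(1 − ε) > 2
  have h1ε : 0 < 1 - ε := sub_pos.mpr hε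
  obtain ⟨t, ht⟩ := exists_nat_gt (2 / (1 - ε))
  have ht2 : (2 : ℝ) < (t : ℝ) * (1 - ε) := by
    calc (2 : ℝ) = 2 / (1 - ε) * (1 - ε) := by rw [div_mul_cancel₀ _ (ne_of_gt h1ε)]
      _ < (t : ℝ) * (1 - ε) := mul_lt_mul_of_pos_right ht h1ε
  have hφpos : 0 < Nat.totient (q ^ 2) := Nat.totient_pos.mpr (pow_pos hq.pos 2)
  set R₀ : ℕ := Nat.totient (q ^ 2) * t with hR₀
  have hR₀t : t ≤ R₀ := Nat.le_mul_of_pos_left t hφpos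
  -- (3) the base m: m ≡ q² + 1 − N (mod q²), N ∣ m, m > C, m ≥ 2
  have hcopqN : Nat.Coprime (q ^ 2) N := by
    apply Nat.Coprime.pow_left
    exact (Nat.Prime.coprime_iff_not_dvd hq).mpr
      (fun h => absurd (Nat.le_of_dvd hN h) (not_le.mpr hqN))
  obtain ⟨L, hL⟩ := exists_nat_gt C
  obtain ⟨m, hmq, hmN, hmC, hm2⟩ : ∃ m : ℕ, m ≡ q ^ 2 + 1 - N [MOD q ^ 2] ∧ N ∣ m ∧
      C < (m : ℝ) ∧ 2 ≤ m := by
    obtain ⟨m₀, hm₀q, hm₀N⟩ := Nat.chineseRemainder hcopqN (q ^ 2 + 1 - N) 0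
    refine ⟨m₀ + q ^ 2 * N * (L + 2), ?_, ?_, ?_, ?_⟩
    · have h0 : q ^ 2 * N * (L + 2) ≡ 0 [MOD q ^ 2] :=
        Nat.modEq_zero_iff_dvd.mpr (dvd_mul_of_dvd_left (dvd_mul_right (q ^ 2) N) (L + 2))
      have := hm₀q.add h0
      rwa [add_zero] at this
    · exact dvd_add (Nat.modEq_zero_iff_dvd.mp hm₀N)
        (dvd_mul_of_dvd_left (dvd_mul_left N (q ^ 2)) (L + 2))
    · have hpos : 0 < q ^ 2 * N := Nat.mul_pos (pow_pos hq.pos 2) hN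
      have h1 : L + 2 ≤ q ^ 2 * N * (L + 2) := Nat.le_mul_of_pos_left (L + 2) hpos
      have h2 : L + 2 ≤ m₀ + q ^ 2 * N * (L + 2) := le_add_left h1
      have h3 : ((L + 2 : ℕ) : ℝ) ≤ ((m₀ + q ^ 2 * N * (L + 2) : ℕ) : ℝ) := by exact_mod_cast h2
      push_cast at h3 ⊢
      linarith
    · have hpos : 0 < q ^ 2 * N := Nat.mul_pos (pow_pos hq.pos 2) hN
      have h1 : L + 2 ≤ q ^ 2 * N * (L + 2) := Nat.le_mul_of_pos_left (L + 2) hpos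
      omega
  have hm0 : (0 : ℝ) < (m : ℝ) := by exact_mod_cast (by omega : 0 < m)
  have hm1 : (1 : ℝ) ≤ (m : ℝ) := by exact_mod_cast (by omega : 1 ≤ m)
  -- (4) q ∤ m
  have hqm : ¬ q ∣ m := by
    intro hqdm
    obtain ⟨a, ha⟩ := hqdm
    obtain ⟨b, hb⟩ := Nat.ModEq.dvd hmq
    have hle : N ≤ q ^ 2 + 1 := by omega
    have hb' : ((q : ℤ) ^ 2 + 1 - (N : ℤ)) - (m : ℤ) = (q : ℤ) ^ 2 * b := by
      have := hb; push_cast [Nat.cast_sub hle] at this; linear_combination this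
    have hdvd : (q : ℤ) ∣ ((N - 1 : ℕ) : ℤ) := by
      refine ⟨(q : ℤ) - (a : ℤ) - (q : ℤ) * b, ?_⟩
      have ha' : (m : ℤ) = (q : ℤ) * (a : ℤ) := by exact_mod_cast ha
      push_cast [Nat.cast_sub (by omega : 1 ≤ N)]
      linear_combination (-1 : ℤ) * hb' - ha'
    have hdvdN : q ∣ N - 1 := Int.natCast_dvd_natCast.mp hdvd
    have := Nat.le_of_dvd (by omega) hdvdN
    omega
  have hcopmq2 : Nat.Coprime m (q ^ 2) :=
    Nat.Coprime.pow_right 2 ((Nat.Prime.coprime_iff_not_dvd hq).mpr hqm).symm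
  -- (5) Euler: m^(R₀+1) ≡ m (mod q²)
  have hpow : m ^ (R₀ + 1) ≡ m [MOD q ^ 2] := by
    have h1 : m ^ Nat.totient (q ^ 2) ≡ 1 [MOD q ^ 2] := Nat.ModEq.pow_totient hcopmq2
    have h2 : m ^ R₀ ≡ 1 [MOD q ^ 2] := by
      have := h1.pow t
      rwa [one_pow, ← pow_mul] at this
    have h3 := h2.mul_right m
    rwa [one_mul, ← pow_succ] at h3
  -- (6) y := m^(R₀+1) − 1
  have hy1 : 1 ≤ m ^ (R₀ + 1) := Nat.one_le_pow _ _ (by omega)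
  have hmy : m ≤ m ^ (R₀ + 1) := Nat.le_self_pow (Nat.succ_ne_zero R₀) m
  set y : ℕ := m ^ (R₀ + 1) - 1 with hydef
  have hy0 : 0 < y := by omega
  have hsum1 : 1 + y = m ^ (R₀ + 1) := by omega
  have hsum1' : y + 1 = m ^ (R₀ + 1) := by omega
  -- (7) the archimedean gap at (1, y)
  have hexp : (1 : ℝ) + (((R₀ + 1 : ℕ)) : ℝ) * ε ≤ ((R₀ : ℕ) : ℝ) := by
    have hR : (t : ℝ) ≤ (R₀ : ℝ) := by exact_mod_cast hR₀t
    have h3 : (2 : ℝ) < ((R₀ : ℝ) + 1) * (1 - ε) := by nlinarith [ht2, hR, h1ε]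
    have h4 : ((R₀ : ℝ) + 1) * (1 - ε) = ((R₀ : ℝ) + 1) - ((R₀ : ℝ) + 1) * ε := by ring
    rw [h4] at h3
    push_cast
    linarith
  have hgap : C * (((m ^ (R₀ + 1) : ℕ)) : ℝ) ^ ε < ((m ^ R₀ : ℕ) : ℝ) := by
    have e1 : (((m ^ (R₀ + 1) : ℕ)) : ℝ) ^ ε = (m : ℝ) ^ ((((R₀ + 1 : ℕ)) : ℝ) * ε) := by
      rw [Real.rpow_mul hm0.le, Real.rpow_natCast, Nat.cast_pow]
    have e2 : ((m ^ R₀ : ℕ) : ℝ) = (m : ℝ) ^ ((R₀ : ℕ) : ℝ) := by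
      rw [Real.rpow_natCast, Nat.cast_pow]
    rw [e1, e2]
    calc C * (m : ℝ) ^ ((((R₀ + 1 : ℕ)) : ℝ) * ε)
        < (m : ℝ) * (m : ℝ) ^ ((((R₀ + 1 : ℕ)) : ℝ) * ε) :=
          mul_lt_mul_of_pos_right hmC (Real.rpow_pos_of_pos hm0 _)
      _ = (m : ℝ) ^ (1 + (((R₀ + 1 : ℕ)) : ℝ) * ε) := by rw [Real.rpow_add hm0, Real.rpow_one]
      _ ≤ (m : ℝ) ^ ((R₀ : ℕ) : ℝ) := Real.rpow_le_rpow_of_exponent_le hm1 hexp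
  -- (8) u y = u 1  (pair (1, y), Q = m^R₀)
  have huy1 : u y = u 1 := by
    have hQ : m ^ R₀ * UniqueFactorizationMonoid.radical (1 + y) ∣ 1 + y := by
      rw [hsum1, UniqueFactorizationMonoid.radical_pow m (Nat.succ_ne_zero R₀)]
      calc m ^ R₀ * UniqueFactorizationMonoid.radical m ∣ m ^ R₀ * m :=
            mul_dvd_mul_left _ UniqueFactorizationMonoid.radical_dvd_self
        _ = m ^ (R₀ + 1) := by rw [pow_succ]
    have hsmall := hsm 1 y Nat.one_pos hy0 (Nat.coprime_one_left y)
    rw [hsum1] at hsmall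
    have hR : |(u y : ℝ) - (u 1 : ℝ)| < ((m ^ R₀ : ℕ) : ℝ) := lt_of_le_of_lt hsmall hgap
    have hZ : |u y - u 1| < ((m ^ R₀ : ℕ) : ℤ) := by exact_mod_cast hR
    exact pairForcing u hcoh Nat.one_pos hy0 (Nat.coprime_one_left y) hQ hZ
  -- (9) q² ∣ N + y
  have hdiv : q ^ 2 ∣ N + y := by
    have hA := Nat.ModEq.dvd hpow      -- ↑(q^2) ∣ ↑m - ↑(m^(R₀+1))
    have hB := Nat.ModEq.dvd hmq       -- ↑(q^2) ∣ ↑(q^2+1-N) - ↑m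
    have hle : N ≤ q ^ 2 + 1 := by omega
    have hyZ : (y : ℤ) = (m : ℤ) ^ (R₀ + 1) - 1 := by
      have : ((1 + y : ℕ) : ℤ) = ((m ^ (R₀ + 1) : ℕ) : ℤ) := by rw [hsum1]
      push_cast at this; linarith
    have h := dvd_sub (dvd_add hA hB) (dvd_refl ((q ^ 2 : ℕ) : ℤ))
    have e : ((m : ℕ) : ℤ) - ((m ^ (R₀ + 1) : ℕ) : ℤ) + ((((q ^ 2 + 1 - N : ℕ)) : ℤ) - ((m : ℕ) : ℤ))
        - ((q ^ 2 : ℕ) : ℤ) = -(((N + y : ℕ)) : ℤ) := by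
      push_cast [Nat.cast_sub hle]
      rw [hyZ]; ring
    rw [e, dvd_neg] at h
    exact Int.natCast_dvd_natCast.mp h
  -- (10) u y = u N  (pair (N, y), Q = q)
  have huyN : u y = u N := by
    have hcop : Nat.Coprime N y := by
      have h1 : Nat.Coprime y (y + 1) := Nat.coprime_self_add_right.mpr (Nat.coprime_one_right y)
      have hNd : N ∣ y + 1 := by
        rw [hsum1']; exact hmN.trans (dvd_pow_self m (Nat.succ_ne_zero R₀))
      exact Nat.Coprime.coprime_dvd_left hNd h1.symm
    obtain ⟨w, hw⟩ := hdiv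
    have hradq : UniqueFactorizationMonoid.radical (q ^ 2) = q := by
      rw [Nat.radical_eq_prod_primeFactors, Nat.primeFactors_prime_pow two_ne_zero hq,
        Finset.prod_singleton]
    have hrm : UniqueFactorizationMonoid.radical (q ^ 2 * w) ∣
        q * UniqueFactorizationMonoid.radical w := by
      have := UniqueFactorizationMonoid.radical_mul_dvd (a := q ^ 2) (b := w)
      rwa [hradq] at this
    have hQ : q * UniqueFactorizationMonoid.radical (N + y) ∣ N + y := by
      rw [hw]
      calc q * UniqueFactorizationMonoid.radical (q ^ 2 * w)
          ∣ q * (q * UniqueFactorizationMonoid.radical w) := mul_dvd_mul_left q hrm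
        _ ∣ q * (q * w) :=
          mul_dvd_mul_left q (mul_dvd_mul_left q UniqueFactorizationMonoid.radical_dvd_self)
        _ = q ^ 2 * w := by ring
    have hlt : |u y - u N| < (q : ℤ) := by
      rw [huy1, Int.abs_eq_natAbs]
      exact_mod_cast hqabs
    exact pairForcing u hcoh hN hy0 hcop hQ hlt
  exact huyN.symm.trans huy1

/-- Hence the integral strengthening cannot feed `closes` (which needs every ε > 0). -/
theorem not_integralWitness_of_integralRigid : IntegralRigid → ¬ IntegralWitness := by
  intro hR hW
  obtain ⟨C, u, hcoh, hsm, a, b, ha, hb, hne⟩ := hW (1 / 2) (by norm_num)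
  exact hne (hR (1 / 2) C (by norm_num) u hcoh hsm a b ha hb)

/-- Unconditional corollary (S⁺₅): the denominator-free sector of the crux is EMPTY. -/
theorem no_integralWitness : ¬ IntegralWitness :=
  not_integralWitness_of_integralRigid integralRigid

/-! ## 2. TRANSFER — structured ansätze are classified (both need `LocalForm`, stmt-ABC-1693)

The natural transplants of "logarithmic derivative" structure are an ADDITIVE `s` (`s(mn) = s m + s n`
on coprime pairs: `k(mn) = k m·rad n + k n·rad m`) or a MULTIPLICATIVE one.  Both classes are
settled on paper in the census (Part II §Transfer): additive ⇒ `s ≡ 0`; multiplicative ⇒ `s ≡ 0` or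
`s n = n^(2m)`.  So neither class contains a witness of growth `< 2`. -/

/-- Theorem T-e of the census (conditional on `LocalForm`): an additive coherent `s = k/rad` vanishes. -/
def NoAdditiveWitness : Prop :=
  LocalForm →
    ∀ k : ℕ → ℤ, Coh k →
      (∀ m n : ℕ, 0 < m → 0 < n → Nat.Coprime m n →
        k (m * n) = k m * ((UniqueFactorizationMonoid.radical n : ℕ) : ℤ) +
          k n * ((UniqueFactorizationMonoid.radical m : ℕ) : ℤ)) →
      ∀ n : ℕ, 0 < n → k n = 0

/-- Theorem T-f of the census (conditional on `LocalForm`): a multiplicative coherent `s = k/rad`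
(`k(mn) = k m · k n` on coprime pairs, since `rad` is multiplicative there) is `0` or `n ↦ n^(2m)`,
i.e. `k n = rad n · n^(2m)`; in particular its growth exponent is `0` or `≥ 2`. -/
def MultiplicativeClassification : Prop :=
  LocalForm →
    ∀ k : ℕ → ℤ, Coh k →
      (∀ m n : ℕ, 0 < m → 0 < n → Nat.Coprime m n → k (m * n) = k m * k n) →
      (∀ n : ℕ, 0 < n → k n = 0) ∨
        ∃ m : ℕ, ∀ n : ℕ, 0 < n → k n = ((UniqueFactorizationMonoid.radical n : ℕ) : ℤ) * (n : ℤ) ^ (2 * m)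

/-! ## 3. NEGATION side, recorded as signatures (these are NOT new items; `Rigidity` = stmt-ABC-1691
and `PairGluingOneTwo` = stmt-ABC-13961 are the route's own negative horns).  `Rigidity → ¬ crux`
and `crux → ¬ PairGluingOneTwo`-at-its-ε are one-liners; we record the first. -/

theorem rigidity_kills_crux : Rigidity → ¬ SmallCoherentNonConstant := by
  rintro ⟨ε, hε, hrig⟩ hS
  obtain ⟨C, k, hcoh, hsm, a, b, ha, hb, hne⟩ := hS ε hε
  exact hne (hrig C k hcoh hsm a b ha hb)

end Summit.ABC.ABC.Cruxes.SmallCoherentNonConstant.Strategist2
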